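import Summits.CriticalPhenomena.PercolationContinuityZ3.Theorems.PercNearOneGluingNoHeavyQuantFarGate3Coins
import HarnessLib

/-!
# QUANT lane R8, front "FAR beyond trees", layer one — THE DEGREE-THREE GATE AT THE OBSERVER, XI: the fifteen cells

builds on p205010 (kernel theorem, internal audit signed; external expert review pending)

Support file (`--supports stmt-CriticalPhenomena-4575`), seat `prim-quant-p1` (gen 28); memo
`run/shared/lean/prim/quant/prim-quant-p1-g28/FOR-LEAD-GATE3.md` §1, §4 (a).  Any finite measure; standard axioms; no sorries; no definitions.

The reduced LP of the degree-three gate lives on the fifteen CELLS `(type T, class of K)` with `K = #{b ∈ B : o ~ b off v}` and classes `K = 0`,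
`K = 1`, `2 ≤ K`.  This file splits the events produced by files VIII (`…Gate3LawK`, the `φ` column) and V (`…Gate3Cells`, the types) into cells:
* generic: `Gate3.real_split_K` (`P(Q) = P(Q ∧ K=0) + P(Q ∧ K=1) + P(Q ∧ 2≤K)`), `Gate3.real_split_Kle` (`P(Q ∧ K≤1) = P(Q ∧ K=0) + P(Q ∧ K=1)`);
* the five events of `real_card_le_one_le_K` as sums of cells: `Gate3.real_nGnG_K0_eq`, `real_nGnG_Kle_eq`, `real_nG₁_imp_eq`, `real_nG₂_imp_eq`,
  `real_atMostOne_eq`.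
[cite: Grimmett1999, §1.3 p. 10]; the bookkeeping is [this work].
-/

noncomputable section

namespace Summit.CriticalPhenomena.PercolationContinuityZ3.Theorems

namespace Quant

namespace Gate3

open Finset MeasureTheory Set
open Literature.Probability.LatticeModels
open Literature.Probability.Percolation
open Bundle (offZ)
open scoped Classical

variable {n : ℕ} {o v u₁ u₂ : Fin n} (μ : Measure (BondConfig (Fin n))) [IsFiniteMeasure μ] (B : Finset (Fin n))

/-- Generic split of an off-`v` event by the class of `K`. [this work] -/
theorem real_split_K (Q : BondConfig (Fin n) → Prop) :
    μ.real {ω : BondConfig (Fin n) | Q (offZ {v} ω)} =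
      μ.real {ω : BondConfig (Fin n) | Q (offZ {v} ω) ∧ (B.filter fun b => offZ {v} ω ∈ openConn o b).card = 0} +
        μ.real {ω : BondConfig (Fin n) | Q (offZ {v} ω) ∧ (B.filter fun b => offZ {v} ω ∈ openConn o b).card = 1} +
        μ.real {ω : BondConfig (Fin n) | Q (offZ {v} ω) ∧ 2 ≤ (B.filter fun b => offZ {v} ω ∈ openConn o b).card} := by
  have s1 := EarHair.real_eq_add_of_split μ {ω : BondConfig (Fin n) | Q (offZ {v} ω)}
    {ω : BondConfig (Fin n) | Q (offZ {v} ω) ∧ (B.filter fun b => offZ {v} ω ∈ openConn o b).card ≤ 1}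
    {ω : BondConfig (Fin n) | Q (offZ {v} ω) ∧ 2 ≤ (B.filter fun b => offZ {v} ω ∈ openConn o b).card}
    (fun ω => by
      simp only [Set.mem_setOf_eq]
      constructor
      · intro h
        by_cases hk : (B.filter fun b => offZ {v} ω ∈ openConn o b).card ≤ 1
        · exact Or.inl ⟨h, hk⟩
        · exact Or.inr ⟨h, by omega⟩
      · rintro (h | h)
        · exact h.1
        · exact h.1)
    (fun ω h h' => by simp only [Set.mem_setOf_eq] at h h'; omega)
  have s2 := EarHair.real_eq_add_of_split μ
    {ω : BondConfig (Fin n) | Q (offZ {v} ω) ∧ (B.filter fun b => offZ {v} ω ∈ openConn o b).card ≤ 1}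
    {ω : BondConfig (Fin n) | Q (offZ {v} ω) ∧ (B.filter fun b => offZ {v} ω ∈ openConn o b).card = 0}
    {ω : BondConfig (Fin n) | Q (offZ {v} ω) ∧ (B.filter fun b => offZ {v} ω ∈ openConn o b).card = 1}
    (fun ω => by
      simp only [Set.mem_setOf_eq]
      constructor
      · rintro ⟨hq, hk⟩
        by_cases h0 : (B.filter fun b => offZ {v} ω ∈ openConn o b).card = 0
        · exact Or.inl ⟨hq, h0⟩
        · exact Or.inr ⟨hq, by omega⟩
      · rintro (h | h)
        · exact ⟨h.1, by omega⟩
        · exact ⟨h.1, by omega⟩)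
    (fun ω h h' => by simp only [Set.mem_setOf_eq] at h h'; omega)
  linarith

/-- Generic split of `Q ∧ K ≤ 1`. [this work] -/
theorem real_split_Kle (Q : BondConfig (Fin n) → Prop) :
    μ.real {ω : BondConfig (Fin n) | Q (offZ {v} ω) ∧ (B.filter fun b => offZ {v} ω ∈ openConn o b).card ≤ 1} =
      μ.real {ω : BondConfig (Fin n) | Q (offZ {v} ω) ∧ (B.filter fun b => offZ {v} ω ∈ openConn o b).card = 0} +
        μ.real {ω : BondConfig (Fin n) | Q (offZ {v} ω) ∧ (B.filter fun b => offZ {v} ω ∈ openConn o b).card = 1} :=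
  EarHair.real_eq_add_of_split μ _ _ _
    (fun ω => by
      simp only [Set.mem_setOf_eq]
      constructor
      · rintro ⟨hq, hk⟩
        by_cases h0 : (B.filter fun b => offZ {v} ω ∈ openConn o b).card = 0
        · exact Or.inl ⟨hq, h0⟩
        · exact Or.inr ⟨hq, by omega⟩
      · rintro (h | h)
        · exact ⟨h.1, by omega⟩
        · exact ⟨h.1, by omega⟩)
    (fun ω h h' => by simp only [Set.mem_setOf_eq] at h h'; omega)

/-- `P(¬G₁ ∧ ¬G₂ ∧ K=0) = P(T₀ ∧ K=0) + P(T₃ ∧ K=0)`. [this work] -/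
theorem real_nGnG_K0_eq :
    μ.real {ω : BondConfig (Fin n) | ¬ (openGraph (offZ {v} ω)).Reachable o u₁ ∧ ¬ (openGraph (offZ {v} ω)).Reachable o u₂ ∧
        (B.filter fun b => offZ {v} ω ∈ openConn o b).card = 0} =
      μ.real {ω : BondConfig (Fin n) | (¬ (openGraph (offZ {v} ω)).Reachable o u₁ ∧ ¬ (openGraph (offZ {v} ω)).Reachable o u₂ ∧
          ¬ (openGraph (offZ {v} ω)).Reachable u₁ u₂) ∧ (B.filter fun b => offZ {v} ω ∈ openConn o b).card = 0} +
        μ.real {ω : BondConfig (Fin n) | (¬ (openGraph (offZ {v} ω)).Reachable o u₁ ∧ ¬ (openGraph (offZ {v} ω)).Reachable o u₂ ∧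
          (openGraph (offZ {v} ω)).Reachable u₁ u₂) ∧ (B.filter fun b => offZ {v} ω ∈ openConn o b).card = 0} :=
  EarHair.real_eq_add_of_split μ _ _ _ (fun ω => by simp only [Set.mem_setOf_eq]; tauto) (fun ω h h' => h.1.2.2 h'.1.2.2)

/-- `P(¬G₁ ∧ ¬G₂ ∧ K≤1) = P(T₀ ∧ K≤1) + P(T₃ ∧ K≤1)`. [this work] -/
theorem real_nGnG_Kle_eq :
    μ.real {ω : BondConfig (Fin n) | ¬ (openGraph (offZ {v} ω)).Reachable o u₁ ∧ ¬ (openGraph (offZ {v} ω)).Reachable o u₂ ∧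
        (B.filter fun b => offZ {v} ω ∈ openConn o b).card ≤ 1} =
      μ.real {ω : BondConfig (Fin n) | (¬ (openGraph (offZ {v} ω)).Reachable o u₁ ∧ ¬ (openGraph (offZ {v} ω)).Reachable o u₂ ∧
          ¬ (openGraph (offZ {v} ω)).Reachable u₁ u₂) ∧ (B.filter fun b => offZ {v} ω ∈ openConn o b).card ≤ 1} +
        μ.real {ω : BondConfig (Fin n) | (¬ (openGraph (offZ {v} ω)).Reachable o u₁ ∧ ¬ (openGraph (offZ {v} ω)).Reachable o u₂ ∧
          (openGraph (offZ {v} ω)).Reachable u₁ u₂) ∧ (B.filter fun b => offZ {v} ω ∈ openConn o b).card ≤ 1} :=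
  EarHair.real_eq_add_of_split μ _ _ _ (fun ω => by simp only [Set.mem_setOf_eq]; tauto) (fun ω h h' => h.1.2.2 h'.1.2.2)

/-- `P(¬G₁ ∧ (G₂→K=0) ∧ K≤1) = P(¬G₁ ∧ ¬G₂ ∧ K≤1) + P(T₂ ∧ K=0)`. [this work] -/
theorem real_nG₁_imp_eq :
    μ.real {ω : BondConfig (Fin n) | ¬ (openGraph (offZ {v} ω)).Reachable o u₁ ∧
        ((openGraph (offZ {v} ω)).Reachable o u₂ → (B.filter fun b => offZ {v} ω ∈ openConn o b).card = 0) ∧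
        (B.filter fun b => offZ {v} ω ∈ openConn o b).card ≤ 1} =
      μ.real {ω : BondConfig (Fin n) | ¬ (openGraph (offZ {v} ω)).Reachable o u₁ ∧ ¬ (openGraph (offZ {v} ω)).Reachable o u₂ ∧
          (B.filter fun b => offZ {v} ω ∈ openConn o b).card ≤ 1} +
        μ.real {ω : BondConfig (Fin n) | ((openGraph (offZ {v} ω)).Reachable o u₂ ∧ ¬ (openGraph (offZ {v} ω)).Reachable o u₁) ∧
          (B.filter fun b => offZ {v} ω ∈ openConn o b).card = 0} := by
  refine EarHair.real_eq_add_of_split μ _ _ _ (fun ω => ?_) (fun ω h h' => h.2.1 h'.1.1)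
  simp only [Set.mem_setOf_eq]
  constructor
  · rintro ⟨h1, himp, hk⟩
    by_cases h2 : (openGraph (offZ {v} ω)).Reachable o u₂
    · exact Or.inr ⟨⟨h2, h1⟩, himp h2⟩
    · exact Or.inl ⟨h1, h2, hk⟩
  · rintro (⟨h1, h2, hk⟩ | ⟨⟨h2, h1⟩, hk⟩)
    · exact ⟨h1, fun h => absurd h h2, hk⟩
    · exact ⟨h1, fun _ => hk, by omega⟩

/-- `P(¬G₂ ∧ (G₁→K=0) ∧ K≤1) = P(¬G₁ ∧ ¬G₂ ∧ K≤1) + P(T₁ ∧ K=0)`. [this work] -/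
theorem real_nG₂_imp_eq :
    μ.real {ω : BondConfig (Fin n) | ¬ (openGraph (offZ {v} ω)).Reachable o u₂ ∧
        ((openGraph (offZ {v} ω)).Reachable o u₁ → (B.filter fun b => offZ {v} ω ∈ openConn o b).card = 0) ∧
        (B.filter fun b => offZ {v} ω ∈ openConn o b).card ≤ 1} =
      μ.real {ω : BondConfig (Fin n) | ¬ (openGraph (offZ {v} ω)).Reachable o u₁ ∧ ¬ (openGraph (offZ {v} ω)).Reachable o u₂ ∧
          (B.filter fun b => offZ {v} ω ∈ openConn o b).card ≤ 1} +
        μ.real {ω : BondConfig (Fin n) | ((openGraph (offZ {v} ω)).Reachable o u₁ ∧ ¬ (openGraph (offZ {v} ω)).Reachable o u₂) ∧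
          (B.filter fun b => offZ {v} ω ∈ openConn o b).card = 0} := by
  refine EarHair.real_eq_add_of_split μ _ _ _ (fun ω => ?_) (fun ω h h' => h.1 h'.1.1)
  simp only [Set.mem_setOf_eq]
  constructor
  · rintro ⟨h2, himp, hk⟩
    by_cases h1 : (openGraph (offZ {v} ω)).Reachable o u₁
    · exact Or.inr ⟨⟨h1, h2⟩, himp h1⟩
    · exact Or.inl ⟨h1, h2, hk⟩
  · rintro (⟨h1, h2, hk⟩ | ⟨⟨h1, h2⟩, hk⟩)
    · exact ⟨h2, fun h => absurd h h1, hk⟩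
    · exact ⟨h2, fun _ => hk, by omega⟩

/-- `P([G₁]+[G₂]+K ≤ 1) = P(¬G₁ ∧ (G₂→K=0) ∧ K≤1) + P(T₁ ∧ K=0)`. [this work] -/
theorem real_atMostOne_eq :
    μ.real {ω : BondConfig (Fin n) | ¬ ((openGraph (offZ {v} ω)).Reachable o u₁ ∧ (openGraph (offZ {v} ω)).Reachable o u₂) ∧
        ((openGraph (offZ {v} ω)).Reachable o u₁ → (B.filter fun b => offZ {v} ω ∈ openConn o b).card = 0) ∧
        ((openGraph (offZ {v} ω)).Reachable o u₂ → (B.filter fun b => offZ {v} ω ∈ openConn o b).card = 0) ∧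
        (B.filter fun b => offZ {v} ω ∈ openConn o b).card ≤ 1} =
      μ.real {ω : BondConfig (Fin n) | ¬ (openGraph (offZ {v} ω)).Reachable o u₁ ∧
          ((openGraph (offZ {v} ω)).Reachable o u₂ → (B.filter fun b => offZ {v} ω ∈ openConn o b).card = 0) ∧
          (B.filter fun b => offZ {v} ω ∈ openConn o b).card ≤ 1} +
        μ.real {ω : BondConfig (Fin n) | ((openGraph (offZ {v} ω)).Reachable o u₁ ∧ ¬ (openGraph (offZ {v} ω)).Reachable o u₂) ∧
          (B.filter fun b => offZ {v} ω ∈ openConn o b).card = 0} := by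
  refine EarHair.real_eq_add_of_split μ _ _ _ (fun ω => ?_) (fun ω h h' => h.1 h'.1.1)
  simp only [Set.mem_setOf_eq]
  constructor
  · rintro ⟨h12, hi1, hi2, hk⟩
    by_cases h1 : (openGraph (offZ {v} ω)).Reachable o u₁
    · exact Or.inr ⟨⟨h1, fun h2 => h12 ⟨h1, h2⟩⟩, hi1 h1⟩
    · exact Or.inl ⟨h1, hi2, hk⟩
  · rintro (⟨h1, hi2, hk⟩ | ⟨⟨h1, h2⟩, hk⟩)
    · exact ⟨fun h => h1 h.1, fun h => absurd h h1, hi2, hk⟩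
    · exact ⟨fun h => h2 h.2, fun _ => hk, fun h => absurd h h2, by omega⟩

end Gate3

end Quant

end Summit.CriticalPhenomena.PercolationContinuityZ3.Theorems
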